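import Summits.BirchSwinnertonDyer.BirchSwinnertonDyer.Theorems.TameQuarticManinParityIIIHasTameGoodModel
import Summits.BirchSwinnertonDyer.BirchSwinnertonDyer.Theorems.TameQuarticManinParityTameThreeOfColength
import HarnessLib

/-!
# Route `TameQuarticManinParity`, LINE 41 (bsd-idea-3 g11): the Kodaira-III* mirror of S41 — a III* (t′) row at `3`
# acquires GOOD reduction over `K = ℚ(ϖ)`, `ϖ⁸ = −3`, with Néron exponent `6` (`--supports` E57′, stmt-BirchSwinnertonDyer-24046)

Cell `pub/bsd-wall`, D-0145 line `route-BirchSwinnertonDyer-TeichmullerTwistDescent`, seat `bsd-line-ttd-p1` g15.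
BSD is NOT proved by this; Manin's conjecture is not proved by this; E57′ (`TprimeTameStarredOptimalManinUnit`,
stmt-24046) and COL(III) (stmt-24044) stay OPEN. THEOREMS ONLY; no definition, no named fact, no `sorry`.

## What is proved

`hasTameGoodModel_six_of_subTprime_of_padicValInt_eq_nine`: for `W/ℚ` elliptic and globally minimal with
`Addv W 3`, `SubTprime W 3`, `ord₃ Δ_min(W) = 9` (Kodaira III*): `HasTameGoodModel 3 8 W 6`. With the typer's
N38b/N38c at `a = 6` (`tameColength_add_jdeg_eq_of_hasTameGoodModel`,
`not_dvd_maninConstant_iff_tameColength_le_of_hasTameGoodModel`) this reads the III* cell E57′ as the colength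
bound `col_K(III*) ≤ 6`, symmetrically to LINE 41's III cell (S41 = `IIIGoodModel.tprimeIIIHasTameGoodModel_proof`).
It also settles the `TODO(general form)` left in `ModularJacobianNeronDifferentialsTameProofs`
(`hasTameGoodModel_three_eight_two_of_short`: short models only) for both tame quartic types, and records
the III* mirror of the glue G41a: `tprimeTameStarredOptimalManinUnit_of_colIIIstar` — **E57′ ⟸ «col_K(III*) ≤ 6» ∧
`nonempty_tameNeronFormsAt`** (the colength bound spelled out as a hypothesis; it is not a route item).

## Proof

Same as S41 with Silverman's Step-9 profile: the tree's ℚ-rational Tate normal form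
`exists_variableChange_tateNormalForm_IIIstar` gives `C = (u₀, r, s, t)` with `ord₃ a₁ ≥ 1`, `ord₃ a₂ ≥ 2`,
`ord₃ a₃, a₄ ≥ 3`, `ord₃ a₆ ≥ 5`, `ord₃ Δ = 9`; `u₀` is a `3`-unit (discriminants), `r, s, t ∈ ℤ_(3)` (AEC
VII.1.3(b) rigidity at the place `(3)`), and `(ϖ⁶, r, s, t) • W_ℂ` has `a₁' = −(u₀a₁/3)ϖ²`, `a₂' = (u₀²a₂/9)ϖ⁴`,
`a₃' = −(u₀³a₃/27)ϖ⁶`, `a₄' = −u₀⁴a₄/27`, `a₆' = −(u₀⁶a₆/243)ϖ⁴`, `Δ' = −u₀¹²Δ₁/3⁹` (`ϖ⁸ = −3`), all in `O_K`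
with `Δ'` a unit. Axioms `propext`, `Classical.choice`, `Quot.sound`.

References: [SilvermanATAEC1994] IV.9.4 Step 9, Table 4.1; [SilvermanAEC2009] III Table 3.1, VII.1 Prop. 1.3,
Remark 1.1; [Kraus1990] Thm. 1 (`p = 3`: type III* ⇒ `e = 4`); [FreitasKraus2022] §4.
-/

set_option autoImplicit false
-- D-0017: single-problem summit, so `Summit.BirchSwinnertonDyer.BirchSwinnertonDyer.…` repeats a namespace BY DESIGN.
set_option linter.dupNamespace false

noncomputable section

open scoped Classical

open WeierstrassCurve IsDedekindDomain IsDedekindDomain.HeightOneSpectrum Rat.HeightOneSpectrum WithZero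
  Literature.NumberTheory.EllipticCurves Literature.NumberTheory.EllipticCurves.ModularForms
  Literature.NumberTheory.EllipticCurves.Rank1Residual Literature.NumberTheory.DiophantineGeometry
  Summit.BirchSwinnertonDyer.Rank1Residual.Additive

namespace Summit.BirchSwinnertonDyer.BirchSwinnertonDyer.Theorems.TameQuarticManinParity.IIIstarGoodModel

open IIIGoodModel

/-! ### The Kodaira-III* rows: exponent `6` -/

/-- The six rescaling factors `(ϖ⁶)^{−i}`, `i = 1, 2, 3, 4, 6, 12`, in the normal form `t·ϖ^m`, `t ∈ ℚ`
(`ϖ⁸ = −3`). [cite: SerreLocalFields1979, Ch. I §6, Prop. 17] -/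
theorem tameUnif_pow_six_inv_pows :
    (tameUnif 3 8 ^ 6)⁻¹ = -(tameUnif 3 8 ^ 2) / 3 ∧ (tameUnif 3 8 ^ 6)⁻¹ ^ 2 = tameUnif 3 8 ^ 4 / 9 ∧
    (tameUnif 3 8 ^ 6)⁻¹ ^ 3 = -(tameUnif 3 8 ^ 6) / 27 ∧ (tameUnif 3 8 ^ 6)⁻¹ ^ 4 = -1 / 27 ∧
    (tameUnif 3 8 ^ 6)⁻¹ ^ 6 = -(tameUnif 3 8 ^ 4) / 243 ∧ (tameUnif 3 8 ^ 6)⁻¹ ^ 12 = -1 / 3 ^ 9 := by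
  set ϖ := tameUnif 3 8 with hϖdef
  have hϖ : ϖ ≠ 0 := tameUnif_ne_zero 8 (by norm_num)
  have h8 : ϖ ^ 8 = -3 := by
    have := tameUnif_pow (p := 3) (e := 8) (by norm_num); exact_mod_cast this
  have key : ∀ (k : ℕ) (y : ℂ), ϖ ^ (6 * k) * y = 1 → (ϖ ^ 6)⁻¹ ^ k = y := fun k y h ↦ by
    rw [inv_pow, ← pow_mul]
    exact inv_eq_of_mul_eq_one_right h
  refine ⟨?_, key 2 _ ?_, key 3 _ ?_, key 4 _ ?_, key 6 _ ?_, key 12 _ ?_⟩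
  · have h := key 1 (-(ϖ ^ 2) / 3) (by linear_combination (-1 / 3 : ℂ) * h8)
    simpa using h
  · linear_combination ((ϖ ^ 8 - 3) / 9 : ℂ) * h8
  · linear_combination (-(ϖ ^ 16 - 3 * ϖ ^ 8 + 9) / 27 : ℂ) * h8
  · linear_combination (-(ϖ ^ 16 - 3 * ϖ ^ 8 + 9) / 27 : ℂ) * h8
  · linear_combination (-(ϖ ^ 32 - 3 * ϖ ^ 24 + 9 * ϖ ^ 16 - 27 * ϖ ^ 8 + 81) / 243 : ℂ) * h8
  · linear_combination (-(ϖ ^ 64 - 3 * ϖ ^ 56 + 9 * ϖ ^ 48 - 27 * ϖ ^ 40 + 81 * ϖ ^ 32 - 243 * ϖ ^ 24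
      + 729 * ϖ ^ 16 - 2187 * ϖ ^ 8 + 6561) / 3 ^ 9 : ℂ) * h8

/-- **S41* (the III* mirror of `TprimeIIIHasTameGoodModel`)**: every globally minimal (t′) curve at `3` with
`ord₃ Δ_min = 9` (Kodaira III*) acquires good reduction over `K = ℚ(ϖ)`, `ϖ⁸ = −3`, through a change of
variables `(ϖ⁶, r, s, t)` with `r, s, t ∈ ℤ_(3) ⊂ O_K` — the rational Tate normal form of Step 9 (profile
`(1,2,3,3,5)`, `v(Δ) = 9`, tree `exists_variableChange_tateNormalForm_IIIstar`) rescaled by `ϖ⁶ u₀⁻¹`: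
`a₁' = −(u₀a₁/3)ϖ²`, `a₂' = (u₀²a₂/9)ϖ⁴`, `a₃' = −(u₀³a₃/27)ϖ⁶`, `a₄' = −u₀⁴a₄/27`, `a₆' = −(u₀⁶a₆/243)ϖ⁴`,
`Δ' = −u₀¹²Δ₁/3⁹`. This is the hypothesis `HasTameGoodModel 3 8 W 6` under which N38b/N38c read the III*
cell (E57′, stmt-24046) as the colength bound `col_K ≤ 6`.
[cite: SilvermanATAEC1994, IV.9.4 Step 9 and Table 4.1] [cite: SilvermanAEC2009, VII.1 Prop. 1.3 (b), (d) and Remark 1.1] -/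
theorem hasTameGoodModel_six_of_subTprime_of_padicValInt_eq_nine (W : WeierstrassCurve ℚ) [W.IsElliptic]
    [W.IsGloballyMinimal] (hadd : Addv W 3) (ht : SubTprime W 3)
    (h9 : padicValInt 3 W.minimalDiscriminantInt = 9) : HasTameGoodModel 3 8 W 6 := by
  haveI : Fact (Nat.Prime 3) := ⟨Nat.prime_three⟩
  haveI : PerfectField (IsLocalRing.ResidueField ((placeOf 3).adicCompletionIntegers ℚ)) :=
    PerfectField.ofFinite
  set v := placeOf 3 with hvdef
  -- (t′) with `ord₃ Δ_min = 3` is Kodaira III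
  have hK : W.kodairaSymbolAt v = .IIIstar := by
    rcases TwistPairAtThree.kodairaSymbolAt_and_padicValInt_of_subTprime W hadd ht with ⟨-, h3⟩ | ⟨h, -⟩
    · omega
    · exact h
  have h2 : ringChar (ℤ ⧸ v.asIdeal) ≠ 2 := by rw [hvdef, ringChar_int_quot_placeOf 3]; decide
  -- the rational Tate normal form
  obtain ⟨C, c₁, c₂, c₃, c₄, c₆, cΔ⟩ := W.exists_variableChange_tateNormalForm_IIIstar v h2 hK
  set W₁ := C • W with hW₁
  -- `u₀` is a `3`-unit
  have hΔW : v.valuation ℚ W.Δ = exp (-9 : ℤ) := by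
    rw [hvdef, valuation_placeOf_Δ_eq 3 W, h9]; rfl
  have hu : v.valuation ℚ (C.u : ℚ) = 1 := by
    have hui0 : v.valuation ℚ (↑C.u⁻¹ : ℚ) ≠ 0 := (Valuation.ne_zero_iff _).mpr (C.u⁻¹).ne_zero
    have h12 : v.valuation ℚ (↑C.u⁻¹ : ℚ) ^ 12 = 1 := by
      have h := cΔ
      rw [hW₁, variableChange_Δ, map_mul, map_pow, hΔW] at h
      have hne : (exp (-9 : ℤ) : ℤᵐ⁰) ≠ 0 := exp_ne_zero
      calc v.valuation ℚ (↑C.u⁻¹ : ℚ) ^ 12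
          = v.valuation ℚ (↑C.u⁻¹ : ℚ) ^ 12 * exp (-9 : ℤ) * (exp (-9 : ℤ))⁻¹ := by
            rw [mul_assoc, mul_inv_cancel₀ hne, mul_one]
        _ = 1 := by rw [h, mul_inv_cancel₀ hne]
    have hlog : v.valuation ℚ (↑C.u⁻¹ : ℚ) = exp (log (v.valuation ℚ (↑C.u⁻¹ : ℚ))) := (exp_log hui0).symm
    have hone : v.valuation ℚ (↑C.u⁻¹ : ℚ) = 1 := by
      rw [hlog, ← exp_nsmul, ← exp_zero, exp_inj] at h12
      rw [hlog, ← exp_zero, exp_inj]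
      simpa using h12
    have hprod : v.valuation ℚ (C.u : ℚ) * v.valuation ℚ (↑C.u⁻¹ : ℚ) = 1 := by
      rw [← map_mul, C.u.mul_inv, map_one]
    rw [hone, mul_one] at hprod
    exact hprod
  -- integrality of `W` (globally minimal) and of the normal form `W₁`
  have h3le : v.valuation ℚ (3 : ℚ) ≤ 1 := by
    have h := valuation_intCast_le_one 3
    rw [hvdef]; exact_mod_cast h
  have hle1 : ∀ {x : ℚ} {k : ℕ}, v.valuation ℚ x ≤ exp (-(k : ℤ)) → v.valuation ℚ x ≤ 1 :=
    fun {x k} h ↦ h.trans (by rw [← exp_zero, exp_le_exp]; omega)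
  have hZ : (W.integralModelInt).map (Int.castRingHom ℚ) = W := map_integralModelInt W
  have iW : v.valuation ℚ W.a₁ ≤ 1 ∧ v.valuation ℚ W.a₂ ≤ 1 ∧ v.valuation ℚ W.a₃ ≤ 1 ∧
      v.valuation ℚ W.a₄ ≤ 1 ∧ v.valuation ℚ W.a₆ ≤ 1 ∧ v.valuation ℚ W.b₂ ≤ 1 ∧ v.valuation ℚ W.b₄ ≤ 1 ∧
      v.valuation ℚ W.b₆ ≤ 1 ∧ v.valuation ℚ W.b₈ ≤ 1 := by
    refine ⟨?_, ?_, ?_, ?_, ?_, ?_, ?_, ?_, ?_⟩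
    · rw [← hZ, map_a₁]; exact valuation_intCast_le_one _
    · rw [← hZ, map_a₂]; exact valuation_intCast_le_one _
    · rw [← hZ, map_a₃]; exact valuation_intCast_le_one _
    · rw [← hZ, map_a₄]; exact valuation_intCast_le_one _
    · rw [← hZ, map_a₆]; exact valuation_intCast_le_one _
    · rw [← hZ, map_b₂]; exact valuation_intCast_le_one _
    · rw [← hZ, map_b₄]; exact valuation_intCast_le_one _
    · rw [← hZ, map_b₆]; exact valuation_intCast_le_one _
    · rw [← hZ, map_b₈]; exact valuation_intCast_le_one _
  obtain ⟨iWa₁, iWa₂, iWa₃, iWa₄, iWa₆, iWb₂, iWb₄, iWb₆, iWb₈⟩ := iW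
  have i₁a₁ : v.valuation ℚ W₁.a₁ ≤ 1 := hle1 (k := 1) (by simpa using c₁)
  have i₁a₂ : v.valuation ℚ W₁.a₂ ≤ 1 := hle1 (k := 2) (by simpa using c₂)
  have i₁a₃ : v.valuation ℚ W₁.a₃ ≤ 1 := hle1 (k := 3) (by simpa using c₃)
  have i₁a₄ : v.valuation ℚ W₁.a₄ ≤ 1 := hle1 (k := 3) (by simpa using c₄)
  have i₁a₆ : v.valuation ℚ W₁.a₆ ≤ 1 := hle1 (k := 5) (by simpa using c₆)
  have hI : ∀ {x : ℚ}, x ∈ (v.valuation ℚ).integer ↔ v.valuation ℚ x ≤ 1 := Valuation.mem_integer_iff _ _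
  have m₁ := hI.2 i₁a₁
  have m₂ := hI.2 i₁a₂
  have m₃ := hI.2 i₁a₃
  have m₄ := hI.2 i₁a₄
  have m₆ := hI.2 i₁a₆
  have i₁b₆ : v.valuation ℚ W₁.b₆ ≤ 1 := by
    refine hI.1 ?_
    simp only [WeierstrassCurve.b₆]
    exact add_mem (pow_mem m₃ 2) (mul_mem (ofNat_mem _ _) m₆)
  have i₁b₈ : v.valuation ℚ W₁.b₈ ≤ 1 := by
    refine hI.1 ?_
    simp only [WeierstrassCurve.b₈]
    exact sub_mem (add_mem (sub_mem (add_mem (mul_mem (pow_mem m₁ 2) m₆)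
      (mul_mem (mul_mem (ofNat_mem _ _) m₂) m₆)) (mul_mem (mul_mem m₁ m₃) m₄)) (mul_mem m₂ (pow_mem m₃ 2)))
      (pow_mem m₄ 2)
  -- rigidity (Silverman AEC VII.1.3 (b)): `r, s, t ∈ ℤ_(3)`
  have hr : v.valuation ℚ C.r ≤ 1 := by
    have hA : v.valuation ℚ ((C.u : ℚ) ^ 6 * W₁.b₆ - W.b₆) ≤ 1 := by
      refine Valuation.map_sub_le _ ?_ iWb₆
      rw [map_mul, map_pow, hu, one_pow, one_mul]; exact i₁b₆
    have hB : v.valuation ℚ ((C.u : ℚ) ^ 8 * W₁.b₈ - W.b₈) ≤ 1 := by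
      refine Valuation.map_sub_le _ ?_ iWb₈
      rw [map_mul, map_pow, hu, one_pow, one_mul]; exact i₁b₈
    have e₆ : (C.u : ℚ) ^ 6 * W₁.b₆ - W.b₆ = 2 * C.r * W.b₄ + C.r ^ 2 * W.b₂ + 4 * C.r ^ 3 := by
      rw [hW₁, variableChange_b₆]
      linear_combination (W.b₆ + 2 * C.r * W.b₄ + C.r ^ 2 * W.b₂ + 4 * C.r ^ 3) *
        pow_mul_pow_eq_one 6 C.u.mul_inv
    have e₈ : (C.u : ℚ) ^ 8 * W₁.b₈ - W.b₈ =
        3 * C.r * W.b₆ + 3 * C.r ^ 2 * W.b₄ + C.r ^ 3 * W.b₂ + 3 * C.r ^ 4 := by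
      rw [hW₁, variableChange_b₈]
      linear_combination (W.b₈ + 3 * C.r * W.b₆ + 3 * C.r ^ 2 * W.b₄ + C.r ^ 3 * W.b₂
        + 3 * C.r ^ 4) * pow_mul_pow_eq_one 8 C.u.mul_inv
    refine valuation_le_one_of_pow_four_eq (v.valuation ℚ) (x := C.r)
      (p := W.b₄) (q := 3 * W.b₆ + ((C.u : ℚ) ^ 6 * W₁.b₆ - W.b₆))
      (c := -((C.u : ℚ) ^ 8 * W₁.b₈ - W.b₈)) iWb₄ ?_ ?_ ?_
    · refine Valuation.map_add_le _ ?_ hA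
      rw [map_mul]
      exact mul_le_one' h3le iWb₆
    · rw [Valuation.map_neg]; exact hB
    · linear_combination e₈ - C.r * e₆
  have hs : v.valuation ℚ C.s ≤ 1 := by
    have e₂ : C.s ^ 2 = (-W.a₁) * C.s + (W.a₂ + 3 * C.r - (C.u : ℚ) ^ 2 * W₁.a₂) := by
      rw [hW₁, variableChange_a₂]
      linear_combination (W.a₂ - C.s * W.a₁ + 3 * C.r - C.s ^ 2) * pow_mul_pow_eq_one 2 C.u.mul_inv
    refine valuation_le_one_of_sq_eq (v.valuation ℚ) (by rwa [Valuation.map_neg]) ?_ e₂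
    refine Valuation.map_sub_le _ (Valuation.map_add_le _ iWa₂ ?_) ?_
    · rw [map_mul]
      exact mul_le_one' h3le hr
    · rw [map_mul, map_pow, hu, one_pow, one_mul]; exact i₁a₂
  have htt : v.valuation ℚ C.t ≤ 1 := by
    have e₆ : C.t ^ 2 = (-(W.a₃ + C.r * W.a₁)) * C.t +
        (W.a₆ + C.r * W.a₄ + C.r ^ 2 * W.a₂ + C.r ^ 3 - (C.u : ℚ) ^ 6 * W₁.a₆) := by
      rw [hW₁, variableChange_a₆]
      linear_combination (W.a₆ + C.r * W.a₄ + C.r ^ 2 * W.a₂ + C.r ^ 3 - C.t * W.a₃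
        - C.t ^ 2 - C.r * C.t * W.a₁) * pow_mul_pow_eq_one 6 C.u.mul_inv
    have hr2 : v.valuation ℚ (C.r ^ 2) ≤ 1 := by rw [map_pow]; exact pow_le_one' hr 2
    have hr3 : v.valuation ℚ (C.r ^ 3) ≤ 1 := by rw [map_pow]; exact pow_le_one' hr 3
    refine valuation_le_one_of_sq_eq (v.valuation ℚ) ?_ ?_ e₆
    · rw [Valuation.map_neg]
      refine Valuation.map_add_le _ iWa₃ ?_
      rw [map_mul]; exact mul_le_one' hr iWa₁
    · refine Valuation.map_sub_le _ ?_ ?_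
      · refine Valuation.map_add_le _ (Valuation.map_add_le _ (Valuation.map_add_le _ iWa₆ ?_) ?_) hr3
        · rw [map_mul]; exact mul_le_one' hr iWa₄
        · rw [map_mul]; exact mul_le_one' hr2 iWa₂
      · rw [map_mul, map_pow, hu, one_pow, one_mul]; exact i₁a₆
  -- the `3`-adic data in `padicValRat` currency
  have hu0 : (C.u : ℚ) ≠ 0 := C.u.ne_zero
  have vu : padicValRat 3 (C.u : ℚ) = 0 := padicValRat_eq_zero_of_valuation_eq_one hu0 hu
  have vr : 0 ≤ padicValRat 3 C.r := padicValRat_nonneg_of_valuation_le_one hr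
  have vs : 0 ≤ padicValRat 3 C.s := padicValRat_nonneg_of_valuation_le_one hs
  have vt : 0 ≤ padicValRat 3 C.t := padicValRat_nonneg_of_valuation_le_one htt
  have va₁ : W₁.a₁ ≠ 0 → ((1 : ℕ) : ℤ) ≤ padicValRat 3 W₁.a₁ := fun h ↦ le_padicValRat_of_valuation_le h c₁
  have va₂ : W₁.a₂ ≠ 0 → ((2 : ℕ) : ℤ) ≤ padicValRat 3 W₁.a₂ := fun h ↦ le_padicValRat_of_valuation_le h c₂
  have va₃ : W₁.a₃ ≠ 0 → ((3 : ℕ) : ℤ) ≤ padicValRat 3 W₁.a₃ := fun h ↦ le_padicValRat_of_valuation_le h c₃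
  have va₄ : W₁.a₄ ≠ 0 → ((3 : ℕ) : ℤ) ≤ padicValRat 3 W₁.a₄ := fun h ↦ le_padicValRat_of_valuation_le h c₄
  have va₆ : W₁.a₆ ≠ 0 → ((5 : ℕ) : ℤ) ≤ padicValRat 3 W₁.a₆ := fun h ↦ le_padicValRat_of_valuation_le h c₆
  have hΔ₁0 : W₁.Δ ≠ 0 := by
    intro h0; rw [h0, map_zero] at cΔ; exact exp_ne_zero cΔ.symm
  have vΔ : padicValRat 3 W₁.Δ = 9 := by
    have h := cΔ
    rw [valuation_three_eq hΔ₁0, exp_inj] at h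
    omega
  -- the coefficients of the normal form, multiplied back by `u₀^i`
  have P₁ : W.a₁ + 2 * C.s = (C.u : ℚ) * W₁.a₁ := by
    rw [hW₁, variableChange_a₁]
    linear_combination (-(W.a₁ + 2 * C.s)) * C.u.mul_inv
  have P₂ : W.a₂ - C.s * W.a₁ + 3 * C.r - C.s ^ 2 = (C.u : ℚ) ^ 2 * W₁.a₂ := by
    rw [hW₁, variableChange_a₂]
    linear_combination (-(W.a₂ - C.s * W.a₁ + 3 * C.r - C.s ^ 2)) * pow_mul_pow_eq_one 2 C.u.mul_inv
  have P₃ : W.a₃ + C.r * W.a₁ + 2 * C.t = (C.u : ℚ) ^ 3 * W₁.a₃ := by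
    rw [hW₁, variableChange_a₃]
    linear_combination (-(W.a₃ + C.r * W.a₁ + 2 * C.t)) * pow_mul_pow_eq_one 3 C.u.mul_inv
  have P₄ : W.a₄ - C.s * W.a₃ + 2 * C.r * W.a₂ - (C.t + C.r * C.s) * W.a₁ + 3 * C.r ^ 2 - 2 * C.s * C.t =
      (C.u : ℚ) ^ 4 * W₁.a₄ := by
    rw [hW₁, variableChange_a₄]
    linear_combination (-(W.a₄ - C.s * W.a₃ + 2 * C.r * W.a₂ - (C.t + C.r * C.s) * W.a₁ + 3 * C.r ^ 2
      - 2 * C.s * C.t)) * pow_mul_pow_eq_one 4 C.u.mul_inv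
  have P₆ : W.a₆ + C.r * W.a₄ + C.r ^ 2 * W.a₂ + C.r ^ 3 - C.t * W.a₃ - C.t ^ 2 - C.r * C.t * W.a₁ =
      (C.u : ℚ) ^ 6 * W₁.a₆ := by
    rw [hW₁, variableChange_a₆]
    linear_combination (-(W.a₆ + C.r * W.a₄ + C.r ^ 2 * W.a₂ + C.r ^ 3 - C.t * W.a₃ - C.t ^ 2
      - C.r * C.t * W.a₁)) * pow_mul_pow_eq_one 6 C.u.mul_inv
  have PΔ : W.Δ = (C.u : ℚ) ^ 12 * W₁.Δ := by
    rw [hW₁, variableChange_Δ]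
    linear_combination (-W.Δ) * pow_mul_pow_eq_one 12 C.u.mul_inv
  -- the complex model `(ϖ², r, s, t) • W_ℂ`
  set ϖ := tameUnif 3 8 with hϖdef
  have hϖ : ϖ ≠ 0 := tameUnif_ne_zero 8 (by norm_num)
  obtain ⟨q₁, q₂, q₃, q₄, q₆, q₁₂⟩ := tameUnif_pow_six_inv_pows
  set T : VariableChange ℂ := ⟨Units.mk0 (ϖ ^ 6) (pow_ne_zero 6 hϖ), (C.r : ℂ), (C.s : ℂ), (C.t : ℂ)⟩ with hT
  have hTu : ((T.u⁻¹ : ℂˣ) : ℂ) = (ϖ ^ 6)⁻¹ := by rw [Units.val_inv_eq_inv_val, hT, Units.val_mk0]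
  have hbc₁ : (W.baseChange ℂ).a₁ = (W.a₁ : ℂ) := by simp [WeierstrassCurve.baseChange, WeierstrassCurve.map]
  have hbc₂ : (W.baseChange ℂ).a₂ = (W.a₂ : ℂ) := by simp [WeierstrassCurve.baseChange, WeierstrassCurve.map]
  have hbc₃ : (W.baseChange ℂ).a₃ = (W.a₃ : ℂ) := by simp [WeierstrassCurve.baseChange, WeierstrassCurve.map]
  have hbc₄ : (W.baseChange ℂ).a₄ = (W.a₄ : ℂ) := by simp [WeierstrassCurve.baseChange, WeierstrassCurve.map]
  have hbc₆ : (W.baseChange ℂ).a₆ = (W.a₆ : ℂ) := by simp [WeierstrassCurve.baseChange, WeierstrassCurve.map]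
  have hbcΔ : (W.baseChange ℂ).Δ = (W.Δ : ℂ) := by
    simp [WeierstrassCurve.baseChange, WeierstrassCurve.map_Δ]
  have hT₁ : (T • W.baseChange ℂ).a₁ = ((-((C.u : ℚ) ^ 1 * W₁.a₁ / 3 ^ 1) : ℚ) : ℂ) * ϖ ^ 2 := by
    rw [variableChange_a₁, hTu, q₁, hbc₁]
    have h : ((W.a₁ : ℚ) : ℂ) + 2 * (C.s : ℂ) = (((C.u : ℚ) * W₁.a₁ : ℚ) : ℂ) := by exact_mod_cast P₁
    simp only [hT]
    rw [h]; push_cast; ring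
  have hT₂ : (T • W.baseChange ℂ).a₂ = (((C.u : ℚ) ^ 2 * W₁.a₂ / 3 ^ 2 : ℚ) : ℂ) * ϖ ^ 4 := by
    rw [variableChange_a₂, hTu, q₂, hbc₁, hbc₂]
    have h : ((W.a₂ : ℚ) : ℂ) - (C.s : ℂ) * (W.a₁ : ℂ) + 3 * (C.r : ℂ) - (C.s : ℂ) ^ 2 =
        (((C.u : ℚ) ^ 2 * W₁.a₂ : ℚ) : ℂ) := by exact_mod_cast P₂
    simp only [hT]
    rw [h]; push_cast; ring
  have hT₃ : (T • W.baseChange ℂ).a₃ = ((-((C.u : ℚ) ^ 3 * W₁.a₃ / 3 ^ 3) : ℚ) : ℂ) * ϖ ^ 6 := by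
    rw [variableChange_a₃, hTu, q₃, hbc₁, hbc₃]
    have h : ((W.a₃ : ℚ) : ℂ) + (C.r : ℂ) * (W.a₁ : ℂ) + 2 * (C.t : ℂ) =
        (((C.u : ℚ) ^ 3 * W₁.a₃ : ℚ) : ℂ) := by exact_mod_cast P₃
    simp only [hT]
    rw [h]; push_cast; ring
  have hT₄ : (T • W.baseChange ℂ).a₄ = ((-((C.u : ℚ) ^ 4 * W₁.a₄ / 3 ^ 3) : ℚ) : ℂ) * ϖ ^ 0 := by
    rw [variableChange_a₄, hTu, q₄, hbc₁, hbc₂, hbc₃, hbc₄]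
    have h : ((W.a₄ : ℚ) : ℂ) - (C.s : ℂ) * (W.a₃ : ℂ) + 2 * (C.r : ℂ) * (W.a₂ : ℂ)
        - ((C.t : ℂ) + (C.r : ℂ) * (C.s : ℂ)) * (W.a₁ : ℂ) + 3 * (C.r : ℂ) ^ 2 - 2 * (C.s : ℂ) * (C.t : ℂ) =
        (((C.u : ℚ) ^ 4 * W₁.a₄ : ℚ) : ℂ) := by exact_mod_cast P₄
    simp only [hT]
    rw [h]; push_cast; ring
  have hT₆ : (T • W.baseChange ℂ).a₆ = ((-((C.u : ℚ) ^ 6 * W₁.a₆ / 3 ^ 5) : ℚ) : ℂ) * ϖ ^ 4 := by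
    rw [variableChange_a₆, hTu, q₆, hbc₁, hbc₂, hbc₃, hbc₄, hbc₆]
    have h : ((W.a₆ : ℚ) : ℂ) + (C.r : ℂ) * (W.a₄ : ℂ) + (C.r : ℂ) ^ 2 * (W.a₂ : ℂ) + (C.r : ℂ) ^ 3
        - (C.t : ℂ) * (W.a₃ : ℂ) - (C.t : ℂ) ^ 2 - (C.r : ℂ) * (C.t : ℂ) * (W.a₁ : ℂ) =
        (((C.u : ℚ) ^ 6 * W₁.a₆ : ℚ) : ℂ) := by exact_mod_cast P₆
    simp only [hT]
    rw [h]; push_cast; ring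
  have hTΔ : (T • W.baseChange ℂ).Δ = ((-((C.u : ℚ) ^ 12 * W₁.Δ / 3 ^ 9) : ℚ) : ℂ) := by
    rw [variableChange_Δ, hTu, q₁₂, hbcΔ, PΔ]
    push_cast; ring
  -- assemble
  refine ⟨hϖ, (C.r : ℂ), (C.s : ℂ), (C.t : ℂ),
    IsPIntegral.isTameIntegral (by norm_num) ⟨C.r, vr, rfl⟩,
    IsPIntegral.isTameIntegral (by norm_num) ⟨C.s, vs, rfl⟩,
    IsPIntegral.isTameIntegral (by norm_num) ⟨C.t, vt, rfl⟩, ?_⟩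
  show IsTameIntegral 3 8 (T • W.baseChange ℂ).a₁ ∧ IsTameIntegral 3 8 (T • W.baseChange ℂ).a₂ ∧
    IsTameIntegral 3 8 (T • W.baseChange ℂ).a₃ ∧ IsTameIntegral 3 8 (T • W.baseChange ℂ).a₄ ∧
    IsTameIntegral 3 8 (T • W.baseChange ℂ).a₆ ∧
    ∃ y : ℂ, IsTameIntegral 3 8 y ∧ (T • W.baseChange ℂ).Δ * y = 1
  rw [hT₁, hT₂, hT₃, hT₄, hT₆, hTΔ]
  refine ⟨?_, ?_, ?_, ?_, ?_, ((-3 ^ 9 / ((C.u : ℚ) ^ 12 * W₁.Δ) : ℚ) : ℂ), ?_, ?_⟩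
  · refine isTameIntegral_ratCast_mul_tameUnif_pow Nat.prime_three (by norm_num) ?_ 2
    rw [padicValRat.neg]; exact padicValRat_rescale_nonneg hu0 vu 1 1 va₁
  · exact isTameIntegral_ratCast_mul_tameUnif_pow Nat.prime_three (by norm_num)
      (padicValRat_rescale_nonneg hu0 vu 2 2 va₂) 4
  · refine isTameIntegral_ratCast_mul_tameUnif_pow Nat.prime_three (by norm_num) ?_ 6
    rw [padicValRat.neg]; exact padicValRat_rescale_nonneg hu0 vu 3 3 va₃
  · refine isTameIntegral_ratCast_mul_tameUnif_pow Nat.prime_three (by norm_num) ?_ 0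
    rw [padicValRat.neg]; exact padicValRat_rescale_nonneg hu0 vu 4 3 va₄
  · refine isTameIntegral_ratCast_mul_tameUnif_pow Nat.prime_three (by norm_num) ?_ 4
    rw [padicValRat.neg]; exact padicValRat_rescale_nonneg hu0 vu 6 5 va₆
  · refine IsPIntegral.isTameIntegral (by norm_num) ⟨-3 ^ 9 / ((C.u : ℚ) ^ 12 * W₁.Δ), ?_, rfl⟩
    rw [padicValRat.div (by norm_num) (mul_ne_zero (pow_ne_zero 12 hu0) hΔ₁0), padicValRat.neg,
      padicValRat.mul (pow_ne_zero 12 hu0) hΔ₁0]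
    simp only [padicValRat.pow]
    rw [vu, vΔ, show (3 : ℚ) = ((3 : ℕ) : ℚ) by norm_num, padicValRat.self (by norm_num)]
    norm_num
  · have hne : (((C.u : ℚ) ^ 12 * W₁.Δ : ℚ) : ℂ) ≠ 0 := by exact_mod_cast mul_ne_zero (pow_ne_zero 12 hu0) hΔ₁0
    push_cast at hne ⊢
    field_simp

/-- **E57′ from a III* colength bound** (the III* mirror of glue G41a, stmt-24076): if on every Kodaira-III*
(t′) row every lattice-optimal, degree-minimal conductor-level datum has `col_K ≤ 6` for every Néron-cotangent
carrier `Λ`, and the carrier exists at `v₃(N) = 2` (`nonempty_tameNeronFormsAt`), then E57′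
(`TprimeTameStarredOptimalManinUnit`, stmt-24046) holds — by N38c at `a = 6`
(`not_dvd_maninConstant_iff_tameColength_le_of_hasTameGoodModel`) over the good model of this file.
[cite: EdixhovenManin1991, §4 Prop. 8] -/
theorem tprimeTameStarredOptimalManinUnit_of_colIIIstar
    (hcol : ∀ (W : WeierstrassCurve ℚ) [W.IsElliptic] [W.IsGloballyMinimal] [NeZero (W.conductorNorm ℤ)],
      Addv W 3 → SubTprime W 3 → padicValInt 3 W.minimalDiscriminantInt = 9 → HasTameGoodModel 3 8 W 6 →
      ∀ (Λ : TameNeronFormsAt (W.conductorNorm ℤ) 3 8) (D : ModularParametrizationData W (W.conductorNorm ℤ)),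
        (∀ z ∈ D.L.lattice, ∃ w ∈ periodLattice D.f, z = D.c * w) →
        (∀ (W' : WeierstrassCurve ℚ) [W'.IsElliptic] (D' : ModularParametrizationData W' (W.conductorNorm ℤ)),
            D'.f = D.f → D.modularDegree ≤ D'.modularDegree) → Λ.tameColength D 6 ≤ 6)
    (hne : nonempty_tameNeronFormsAt) :
    Summit.BirchSwinnertonDyer.BirchSwinnertonDyer.Theses.TameQuarticManinParity.TprimeTameStarredOptimalManinUnit := by
  intro W _ _ _ hadd ht h9 D hL hopt
  have h2 := TameQuarticManinParity.padicValNat_conductorNorm_eq_two_of_subTprime W ht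
  obtain ⟨Λ⟩ := nonempty_tameNeronFormsAt_three hne (W.conductorNorm ℤ) h2
  have hgood := hasTameGoodModel_six_of_subTprime_of_padicValInt_eq_nine W hadd ht h9
  exact (Λ.not_dvd_maninConstant_iff_tameColength_le_of_hasTameGoodModel Nat.prime_three (by norm_num) D hL
    hgood).2 (hcol W hadd ht h9 hgood Λ D hL hopt)

end Summit.BirchSwinnertonDyer.BirchSwinnertonDyer.Theorems.TameQuarticManinParity.IIIstarGoodModel

end
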